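import Summits.ResolutionOfSingularities.ResolutionOfSingularities.Theorems.FrobeniusLadderFInjectiveMacaulayficationFDTwoStoreyGermOf
import Summits.ResolutionOfSingularities.ResolutionOfSingularities.Theorems.FrobeniusLadderFInjectiveMacaulayficationFDStorey1BlowupFull
import Summits.ResolutionOfSingularities.ResolutionOfSingularities.Theorems.FrobeniusLadderFInjectiveMacaulayficationFDStorey2L1BlowupFull
import Summits.ResolutionOfSingularities.ResolutionOfSingularities.Theorems.FrobeniusLadderFInjectiveMacaulayficationFDPointFloor
import Summits.ResolutionOfSingularities.ResolutionOfSingularities.Theorems.FrobeniusLadderFInjectiveMacaulayficationFDStorey1PNotFull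
import HarnessLib

/-!
# ★★★ ROW #8 OF THE F-HALF CENSUS — BED D `z⁴ + x⁵z + x⁶ + y³ + u³ + t⁷` (char 2): THE FIRST FORCED TWO-STOREY F-INJECTIVIZATION, `f4pos_rowD_twoStorey` = ⟨legal, not full, cured⟩
# (crux `FInjectiveMacaulayfication` stmt-ResolutionOfSingularities-15315, chain w45a; res-L1-w45a-plan-1 RULINGS R21.15 (2) (W-TD), R21.34 «ROW #8 ROUTE OF RECORD = (W8): LOCAL
# SECOND STOREY», R21.36 (3); seats: storey 1 (D-1) res-L1-w45a-stub-2 g10 `…FDStorey1BlowupFull` on res-L1-w45a-tri-2 g17ʼs 327-chart fan Σ_D^{𝔪K}; storey 2 (W8/L1)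
# res-L1-w45a-stub-3 g11 `…FDStorey2L1BlowupFull` on tri-2ʼs 15-chart fan (kit j318216); input side res-L1-w45a-stub-3 `…FDSpecimen` / `…FDPointFloor`; coordinate handshake, glue and
# assembly res-L1-w45a-stub-1 g12/g13 (`…FHalfRowOfTwoStoreysLocal`, `…ChartModel`, `…FDStorey2ChartIso`, `…FDTwoStoreyRowOf`))

[OURS · L1 W4.5a] Support file (`--supports stmt-ResolutionOfSingularities-15315 --as helper`); def-free, UNCONDITIONAL; replaces the role of NO printed item; NOT a statement of
the manuscript; AI-written (AI review is weaker than expert review). Nothing of the crux is proved: this is ONE row of the F-half census (one germ, one floor, one cure).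

WHY THIS ROW IS NEW. Every earlier row of the census ((4,2) ×5, (5,2) ×2, (4,3) ×1, TCa floor-1-full) was cured by ONE toric storey `Bl_{𝔪·K} X`. BED D is the first bed where NO
single Σ_f-refining toric storey cures the point floor (res-L1-w45a-tri-2ʼs THEOREM D-tor, evidence level: the Tjurina-bad face `(z²+x³)²` is plane-rigid): storey 1 leaves exactly ONE
non-F-pure closed point `P` on the exceptional divisor (chart 277, `𝔪̄_P = (Y₀,Y₁,Y₂+1,Y₃,Y₄)`), and a SECOND, LOCAL storey at `P` along an `𝔪_P`-primary monomial centre in the translated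
coordinates (15 charts, FULL but singular on 10 of them) finishes. The two storeys are ONE blowing up of `Spec 𝒪_{X,v}` along a `v`-cosupported `𝓚` (Temkin 2.1.1/2.1.4, ✓ p664558).
* §1 `twoStorey_fD_row` — for EVERY blowing up `g : S′ → Spec 𝒪_{X,v}` of the point floor: `∃ 𝓚 ≠ ⊥` on `S′`, supported over the closed point, ALL of whose blowings up are FULL
  (`FullCl 2`) at every stalk — ONE term on ✓ `FDTwoStoreyRow.twoStorey_fD_row_of_support` over stub-2ʼs `storey1_fullCl_off_P_mul` and stub-3ʼs `support_idealSheaf_mK` /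
  `affineBlowup_mK_fullCl`.
* §2 ★★★ `f4pos_rowD_twoStorey` — LEGAL ∧ NOT F(4)-iso ∧ CURED (two storeys): the row in the censusʼ letter (✓ p662213 input side + §1).
* §3 ★★ `fD_fInjectivizationGermAt` — the GERM shape `GermForm.FInjectivizationGermAt 2 v` (R21.34 (d)): some `𝓚 ≠ ⊥` on `Spec 𝒪_{X,v}` supported at the closed point, ALL of
  whose blowings up are FULL — ONE term on ✓ `FDTwoStoreyRow.fInjectivizationGermAt_fD_of_support`.
* §4 ★ `storey1_fullCl_iff_ne_P` — WHY TWO STOREYS (kernel-certified part): storey 1 `Bl_{𝔪·K} X_D` has EXACTLY ONE non-FULL point, the closed point `P` over `v`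
  (FULL off `P`: stub-2ʼs `storey1_fullCl_off_P_mul`; NOT FULL at `P`: stub-2ʼs ✓ p672551 `FDStorey1PNotFull.not_fullCl_of_openImmersion`; `P` over `v`: ✓ `comap_span_HS`).
  (That no OTHER single toric storey cures the floor — D-tor — is evidence-level only and NOT claimed here.)
[OURS · assembly of landed theorems] [cite: Temkin2008, Lemma 2.1.1 and Lemma 2.1.4] [cite: StacksProject, Tag 080B] [cite: GortzWedhorn2020, Prop. 13.91 and Prop. 13.92]
-/

-- single-problem summit: the doubled namespace component is forced
set_option linter.dupNamespace false

noncomputable section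

open AlgebraicGeometry CategoryTheory Literature.AlgebraicGeometry.Resolution TopologicalSpace IsLocalRing MvPolynomial

namespace Summit.ResolutionOfSingularities.ResolutionOfSingularities.Theorems.FInjectiveMacaulayfication.FDTwoStoreyRow

open Summit.ResolutionOfSingularities.ResolutionOfSingularities.Theorems.FInjectiveMacaulayfication
open SliceableCentre FDStorey1Fan GermForm FanCheckKit

/-! ## §1 The cure: two storeys -/

set_option maxHeartbeats 800000 in
-- one `obtain` + one `exact` on large statements
/-- ★★ **THE POINT FLOOR OF BED D IS CURED BY TWO STOREYS.** For every blowing up `g : S′ → Spec 𝒪_{X,v}` along `𝔪·𝒪_{X,v}` there is `𝓚 ≠ ⊥` on `S′`, supported over the closed point,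
ALL of whose blowings up are FULL at every stalk. [OURS · assembly of landed theorems] -/
theorem twoStorey_fD_row (k : Type) [Field k] [CharP k 2] (f : MvPolynomial (Fin 5) k) (hf : f = X 4 ^ 4 + X 0 ^ 5 * X 4 + X 0 ^ 6 + X 1 ^ 3 + X 2 ^ 3 + X 3 ^ 7)
    (v : Spec (.of (MvPolynomial (Fin 5) k ⧸ Ideal.span {f})))
    (hv : v.asIdeal = Ideal.span (Set.range (fun j : Fin 5 => Ideal.Quotient.mk (Ideal.span {f}) (X j)))) :
    ∀ (S' : Scheme.{0}) (g : S' ⟶ Spec ((Spec (.of (MvPolynomial (Fin 5) k ⧸ Ideal.span {f}))).presheaf.stalk v)),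
      IsBlowup g ((affineBlowup.idealSheaf (Ideal.span (Set.range (fun j : Fin 5 => Ideal.Quotient.mk (Ideal.span {f}) (X j))))).comap
        ((Spec (.of (MvPolynomial (Fin 5) k ⧸ Ideal.span {f}))).fromSpecStalk v)) →
      ∃ 𝓚 : S'.IdealSheafData, 𝓚 ≠ ⊥ ∧
        (∀ s ∈ (𝓚.support : Set S'), g.base s = closedPoint ((Spec (.of (MvPolynomial (Fin 5) k ⧸ Ideal.span {f}))).presheaf.stalk v)) ∧
        ∀ (S'' : Scheme.{0}) (π : S'' ⟶ S'), IsBlowup π 𝓚 → ∀ s : S'', FullCl 2 (S''.presheaf.stalk s) := by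
  obtain ⟨ι, hι, hcompat, hoff⟩ := FDStorey1BlowupFull.storey1_fullCl_off_P_mul k f hf
  haveI := hι
  exact twoStorey_fD_row_of_support k f hf _ rfl v hv _ (FDStorey1Centre.span_K_ne_bot k f hf) (FDStorey1Centre.span_floor_le_radical_K k f) ι hcompat hoff _ rfl _
    (FDStorey2L1BlowupFull.support_idealSheaf_mK k _ rfl) (FDStorey2L1BlowupFull.affineBlowup_mK_fullCl k _ rfl)

/-! ## §2 ★★★ The two-sided row -/

/-- ★★★ **ROW #8 (BED D, p = 2, TWO STOREYS) AS ONE KERNEL THEOREM: LEGAL ∧ NOT F(4)-iso ∧ CURED.** For every blowing up `g : S′ → Spec 𝒪_{X,v}` along the point floor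
`I = 𝔪̃|_{Spec 𝒪_{X,v}}`: (legal, res-L1-w45a-stub-3 ✓ p662213) `I ≠ ⊥`, `Supp I ⊆ (Reg)ᶜ`, `S′` regular off the closed fibre and CM everywhere; (NOT FULL, ✓ p662213) some stalk of `S′` over
the closed point is NOT `FullCl 2`; (CURED, §1) there is `𝓚 ≠ ⊥` on `S′`, supported over the closed point, ALL of whose blowings up are FULL at every stalk — and NO one-storey toric
cure exists (D-tor, evidence level, not claimed in the kernel). [OURS · assembly of landed theorems] -/
theorem f4pos_rowD_twoStorey (k : Type) [Field k] [CharP k 2] (f : MvPolynomial (Fin 5) k) (hf : f = X 4 ^ 4 + X 0 ^ 5 * X 4 + X 0 ^ 6 + X 1 ^ 3 + X 2 ^ 3 + X 3 ^ 7)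
    (v : Spec (.of (MvPolynomial (Fin 5) k ⧸ Ideal.span {f})))
    (hv : v.asIdeal = Ideal.span (Set.range (fun j : Fin 5 => Ideal.Quotient.mk (Ideal.span {f}) (X j))))
    (S' : Scheme.{0}) (g : S' ⟶ Spec ((Spec (.of (MvPolynomial (Fin 5) k ⧸ Ideal.span {f}))).presheaf.stalk v))
    (hg : IsBlowup g ((affineBlowup.idealSheaf (Ideal.span (Set.range (fun j : Fin 5 => Ideal.Quotient.mk (Ideal.span {f}) (X j))))).comap
      ((Spec (.of (MvPolynomial (Fin 5) k ⧸ Ideal.span {f}))).fromSpecStalk v))) :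
    (((affineBlowup.idealSheaf (Ideal.span (Set.range (fun j : Fin 5 => Ideal.Quotient.mk (Ideal.span {f}) (X j))))).comap
        ((Spec (.of (MvPolynomial (Fin 5) k ⧸ Ideal.span {f}))).fromSpecStalk v)) ≠ ⊥ ∧
      (((((affineBlowup.idealSheaf (Ideal.span (Set.range (fun j : Fin 5 => Ideal.Quotient.mk (Ideal.span {f}) (X j))))).comap
        ((Spec (.of (MvPolynomial (Fin 5) k ⧸ Ideal.span {f}))).fromSpecStalk v))).support :
          Set (Spec ((Spec (.of (MvPolynomial (Fin 5) k ⧸ Ideal.span {f}))).presheaf.stalk v))) ⊆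
        (Scheme.regularLocus (Spec ((Spec (.of (MvPolynomial (Fin 5) k ⧸ Ideal.span {f}))).presheaf.stalk v)))ᶜ) ∧
      (∀ s : S', g.base s ≠ closedPoint ((Spec (.of (MvPolynomial (Fin 5) k ⧸ Ideal.span {f}))).presheaf.stalk v) → s ∈ Scheme.regularLocus S') ∧
      (∀ s : S', CMCl (S'.presheaf.stalk s))) ∧
    (∃ s : S', g.base s = closedPoint ((Spec (.of (MvPolynomial (Fin 5) k ⧸ Ideal.span {f}))).presheaf.stalk v) ∧ ¬ FullCl 2 (S'.presheaf.stalk s)) ∧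
    (∃ 𝓚 : S'.IdealSheafData, 𝓚 ≠ ⊥ ∧
      (∀ s ∈ (𝓚.support : Set S'), g.base s = closedPoint ((Spec (.of (MvPolynomial (Fin 5) k ⧸ Ideal.span {f}))).presheaf.stalk v)) ∧
      ∀ (S'' : Scheme.{0}) (π : S'' ⟶ S'), IsBlowup π 𝓚 → ∀ s : S'', FullCl 2 (S''.presheaf.stalk s)) :=
  ⟨FDPointFloor.pointFloor_fD_input_legal k f hf v hv S' g hg, FDPointFloor.pointFloor_fD_not_full k f hf v hv S' g hg, twoStorey_fD_row k f hf v hv S' g hg⟩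

/-! ## §3 The germ shape -/

set_option maxHeartbeats 800000 in
-- one `obtain` + one `exact` on large statements
/-- ★★ **BED D AT THE GERM: `FInjectivizationGermAt 2 v`** — some `𝓚 ≠ ⊥` on `Spec 𝒪_{X,v}`, supported at the closed point, ALL of whose blowings up are FULL at every stalk
(the two storeys composed into ONE `v`-cosupported blowing up of the germ). [OURS · assembly of landed theorems] -/
theorem fD_fInjectivizationGermAt (k : Type) [Field k] [CharP k 2] (f : MvPolynomial (Fin 5) k) (hf : f = X 4 ^ 4 + X 0 ^ 5 * X 4 + X 0 ^ 6 + X 1 ^ 3 + X 2 ^ 3 + X 3 ^ 7)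
    (v : Spec (.of (MvPolynomial (Fin 5) k ⧸ Ideal.span {f})))
    (hv : v.asIdeal = Ideal.span (Set.range (fun j : Fin 5 => Ideal.Quotient.mk (Ideal.span {f}) (X j)))) :
    FInjectivizationGermAt 2 v := by
  obtain ⟨ι, hι, hcompat, hoff⟩ := FDStorey1BlowupFull.storey1_fullCl_off_P_mul k f hf
  haveI := hι
  exact fInjectivizationGermAt_fD_of_support k f hf _ rfl v hv _ (FDStorey1Centre.span_K_ne_bot k f hf) (FDStorey1Centre.span_floor_le_radical_K k f)
    ι hcompat hoff _ rfl _ (FDStorey2L1BlowupFull.support_idealSheaf_mK k _ rfl) (FDStorey2L1BlowupFull.affineBlowup_mK_fullCl k _ rfl)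

/-! ## §4 Why two storeys: storey 1 has exactly one non-FULL point -/

set_option maxHeartbeats 800000 in
-- large statement; instance constructions on quotient rings
/-- ★ **STOREY 1 OF BED D IS FULL EXACTLY OFF ONE CLOSED POINT `P` OVER `v`.** There is a point `P` of `X₁ = Bl_{𝔪·K} X_D` over the vertex `v` such that for every `y ∈ X₁`:
`X₁` is FULL at `y` iff `y ≠ P`. (So the point floor is not cured by this storey alone, and the second storey of §1 is needed at `P`.) [OURS · assembly of landed theorems] -/
theorem storey1_fullCl_iff_ne_P (k : Type) [Field k] [CharP k 2] (f : MvPolynomial (Fin 5) k) (hf : f = X 4 ^ 4 + X 0 ^ 5 * X 4 + X 0 ^ 6 + X 1 ^ 3 + X 2 ^ 3 + X 3 ^ 7)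
    (v : Spec (.of (MvPolynomial (Fin 5) k ⧸ Ideal.span {f})))
    (hv : v.asIdeal = Ideal.span (Set.range (fun j : Fin 5 => Ideal.Quotient.mk (Ideal.span {f}) (X j)))) :
    ∃ P : ↥(affineBlowup (Ideal.span (Set.range fun j : Fin 5 => Ideal.Quotient.mk (Ideal.span {f}) (X j)) *
          Ideal.span ((fun e : Fin 5 →₀ ℕ => Ideal.Quotient.mk (Ideal.span {f}) (monomial e (1 : k))) '' (genSet 5 KL2 : Set (Fin 5 →₀ ℕ))))),
      (affineBlowup.π _).base P = v ∧
      ∀ y : ↥(affineBlowup (Ideal.span (Set.range fun j : Fin 5 => Ideal.Quotient.mk (Ideal.span {f}) (X j)) *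
          Ideal.span ((fun e : Fin 5 →₀ ℕ => Ideal.Quotient.mk (Ideal.span {f}) (monomial e (1 : k))) '' (genSet 5 KL2 : Set (Fin 5 →₀ ℕ))))),
        FullCl 2 ((affineBlowup (Ideal.span (Set.range fun j : Fin 5 => Ideal.Quotient.mk (Ideal.span {f}) (X j)) *
          Ideal.span ((fun e : Fin 5 →₀ ℕ => Ideal.Quotient.mk (Ideal.span {f}) (monomial e (1 : k))) '' (genSet 5 KL2 : Set (Fin 5 →₀ ℕ))))).presheaf.stalk y) ↔ y ≠ P := by
  classical
  obtain ⟨ι, hι, hcompat, hoff⟩ := FDStorey1BlowupFull.storey1_fullCl_off_P_mul k f hf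
  haveI := hι
  -- the point `P₀ = 𝔪̄_P` of the chart
  have hmax : ((Ideal.span {x | x ∈ HS.map (KLocCellKit.evalL k)}).map
      (Ideal.Quotient.mk (Ideal.span {KLocCellKit.evalL k (G (277 : Fin 327))}))).IsMaximal := by
    haveI := FDStorey1PIdeal.isMaximal_span_HS k
    refine Ideal.IsMaximal.map_of_surjective_of_ker_le Ideal.Quotient.mk_surjective ?_
    rw [Ideal.mk_ker, Ideal.span_le, Set.singleton_subset_iff]
    exact FDStorey1PIdeal.evalL_G_mem_span_HS k 277 (Or.inr rfl)
  let P₀ : Spec (.of (MvPolynomial (Fin 5) k ⧸ Ideal.span {KLocCellKit.evalL k (G (277 : Fin 327))})) :=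
    ⟨(Ideal.span {x | x ∈ HS.map (KLocCellKit.evalL k)}).map (Ideal.Quotient.mk (Ideal.span {KLocCellKit.evalL k (G (277 : Fin 327))})), hmax.isPrime⟩
  have hP₀ : P₀.asIdeal = (Ideal.span {x | x ∈ HS.map (KLocCellKit.evalL k)}).map
      (Ideal.Quotient.mk (Ideal.span {KLocCellKit.evalL k (G (277 : Fin 327))})) := rfl
  refine ⟨ι.base P₀, ?_, fun y => ⟨fun hfull hy => ?_, fun hne => hoff P₀ hP₀ y hne⟩⟩
  · -- over `v`
    apply PrimeSpectrum.ext
    apply Ideal.comap_injective_of_surjective (Ideal.Quotient.mk (Ideal.span {f})) Ideal.Quotient.mk_surjective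
    rw [hcompat P₀, hP₀, comap_span_HS]
    refine (QuotientOriginMaximal.idealOfVars_isMaximal k (n := 5)).eq_of_le (Ideal.comap_isPrime _ _).ne_top ?_
    rw [MvPolynomial.idealOfVars, Ideal.span_le]
    rintro _ ⟨j, rfl⟩
    rw [SetLike.mem_coe, Ideal.mem_comap, hv]
    exact Ideal.subset_span ⟨j, rfl⟩
  · -- not FULL at `P`
    subst hy
    exact FDStorey1PNotFull.not_fullCl_of_openImmersion k ι P₀ hP₀ hfull

end Summit.ResolutionOfSingularities.ResolutionOfSingularities.Theorems.FInjectiveMacaulayfication.FDTwoStoreyRow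

end
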